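import Literature.Computability.AlgebraicComplexity.RazElusiveGeneralDefinable
import Literature.Computability.AlgebraicComplexity.ValiantCompleteness
import HarnessLib

/-!
# Raz 2010, §1 result 1 (`Raz2010_result_1`) from Corollary 5.8

Companion (proofs only, no new named facts) to `RazElusiveGeneral.lean`, where Raz's
introductory "result 1" (Theory of Computing 6 (2010), p. 136) is the named fact
`Raz2010_result_1` and the numbered Corollary 5.8 (= Cor. 1.14, p. 172 / p. 147) is the named
fact `Raz2010_cor_5_8`.

Raz states result 1 as an EXAMPLE of his theorems (p. 136: "For example, we show the following
results: Let `F` be a field of characteristic not equal to `2`. 1. Let `s = s(n)`, `m = m(n)` be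
such that `n^{ω(1)} ≤ m` … and `s ≥ m^{0.9}`. … If there exists an explicit `(s, 2)`-elusive
polynomial mapping, `f : Fⁿ → F^m` (of degree at most poly(`n`)), then any arithmetic circuit
for the permanent, over `F`, is of super-polynomial size."), the theorem behind it being
Cor. 1.14 = Cor. 5.8 (§1.8.3, p. 147: "The full results are restated and proved in
Subsection 5.4"), which is printed for the binomial arities `m = C(n+r-1, r)`, `3 ≤ r ≤ n ≤ s`,
under the growth hypothesis `s / C(n+r'-1, r') ≥ n^{ω(1)}`, `r' = ⌊2r/3⌋`. No separate proof of
result 1 is printed. This file PROVES the implication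

* `Raz2010_result_1_of_cor_5_8 : Raz2010_cor_5_8 F → Raz2010_result_1 F`,

i.e. it makes Raz's parameters explicit for a general arity `m(n) ≥ n^{ω(1)}` with
`s ≥ m^{0.9}`, and records the resulting dependence of result 1 on the two remaining unproved
inputs of Cor. 5.8 in the tree (`Raz2010_result_1_of_parts`: step 1 of the proof of Prop. 3.6 /
5.5, `Raz2010_monomialCircuits`, and the universal-circuit lower bound Cor. 5.7,
`Raz2010_cor_5_7`; Valiant's completeness of the permanent is the theorem
`isVNPComplete_perPoly_holds`).

## The reduction (Raz's parameters made explicit)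

Given an explicit family `f n : Fⁿ → F^{m(n)}` of degree `≤ d(n) = poly(n)`, eventually
`(s(n), 2)`-elusive, with `m ≥ n^{ω(1)}` and `m^9 ≤ s^{10}`:

1. *Arity bound* (`lt_pow_of_isElusive_of_totalDegree_le`, linear algebra): the image of a
   degree-`≤ d` map `Fⁿ → F^m` lies in the image of the LINEAR map `F^E → F^m`,
   `y ↦ (Σ_e coeff_e(f_i) y_e)_i`, `E = {0, …, d}ⁿ` the bounded exponent vectors; so
   `(s, 2)`-elusiveness forces `s < (d+1)ⁿ`, whence `m ≤ s^{10/9} ≤ (d+1)^{10 n} ≤ (n^{2n})ⁿ`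
   for large `n` (`eventually_arity_le_pow`). In particular `m(n)` may exceed
   `C(2n-1, n) ≈ 4ⁿ`, the largest binomial arity available to Cor. 5.8 at the index `n`
   (`r ≤ n`), so dummy variables are needed:
2. *Re-indexing by a quartic root.* View `f n` as a map in `N` variables for every `N` with
   `⌊N^{1/4}⌋ = n` (`Nat.sqrt (Nat.sqrt N)`, `n⁴ ≤ N < (n+1)⁴`; the extra variables are dummies,
   `rename (Fin.castLE _)`), and pad it, by Raz's own formula `i ↦ Σ_e g_n(x, e, bits i)` of
   Def. 1.3, to `C(N + r - 1, r)` coordinates, `r = r(N) ≥ 3` minimal with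
   `C(N + r - 1, r) ≥ m(n)` (`exists_rank_function`). Poly(`n`)-definability is kept with the
   same witness `g_n` (re-indexed variables: `bitSubst_rename_sumMap`, `bitSubst_rename_castLE`,
   `boolSum_rename_sumMap`), and poly(`n`) = poly(`N`); elusiveness is kept (`IsElusive.of_comp`,
   `IsElusive.rename_injective`); by step 1, `r(N) ≤ n² ≤ √N` (`le_choose_multiset_of_le_pow`).
3. *Growth hypothesis of Cor. 5.8* (`rank_growth_of_pow_le`): with `a = r - 1`, `b = ⌊2r/3⌋`,
   `t = a - b` and `a² ≤ N`, minimality of `r` gives `C(N+a-1, a) < m`, and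
   `(N^c · C(N+b-1, b))^{10} ≤ C(N+a-1, a)^9 ≤ m^9 ≤ s^{10}` by the elementary estimates
   `N^t · C(N+b-1, b) ≤ a^t · C(N+a-1, a)` (`pow_mul_choose_multiset_le`) and
   `C(N+b-1, b) ≤ N^b` (`choose_multiset_le_pow`) of `RazElusiveGeneralProofs.lean`, as soon as
   `t ≥ 5c + 1` (and `r → ∞` by `rank_eventually_ge`). The side conditions
   `3 ≤ r ≤ N ≤ s` hold for large `N` (`s ≥ n⁸ ≥ (n+1)⁴ > N`).

Then Cor. 5.8 (over the extension `G = F`) concludes `¬ IsPComputable (PER)`.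

## References

* R. Raz, *Elusive functions and lower bounds for arithmetic circuits*, Theory of Computing 6
  (2010) 135–177: §1, result 1 (p. 136); §1.8.3, Cor. 1.14 (p. 147); Cor. 5.8 (p. 172);
  Def. 1.1, Def. 1.3.
-/

noncomputable section

open MvPolynomial

namespace Literature.Computability.AlgebraicComplexity

universe u v

/-! ### Arity bound: an `(s, 2)`-elusive map of degree `≤ d` in `n` variables has `s < (d+1)ⁿ` -/

section ArityBoundMap

variable {k : Type u} [CommSemiring k]

/-- A polynomial mapping `kⁿ → k^ι` of degree `≤ d` in every coordinate factors through the
LINEAR map `k^E → k^ι`, `y ↦ (Σ_{e ∈ E} coeff_e(f_i) · y_e)_i`, `E = {0, …, d}ⁿ` the exponent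
vectors with entries `< d + 1` (take `y_e = x^e`). [folklore] -/
theorem range_polyMapEval_subset_bddCoeff {ι : Type v} {n d : ℕ} (f : ι → MvPolynomial (Fin n) k)
    (hf : ∀ i, (f i).totalDegree ≤ d) :
    Set.range (polyMapEval f) ⊆ Set.range (polyMapEval fun i =>
      ∑ e : Fin n → Fin (d + 1),
        C (coeff (Finsupp.equivFunOnFinite.symm fun j => (e j : ℕ)) (f i)) * X e) := by
  classical
  rintro _ ⟨x, rfl⟩
  refine ⟨fun e : Fin n → Fin (d + 1) => ∏ j : Fin n, x j ^ (e j : ℕ), funext fun i => ?_⟩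
  -- the bounded exponent vectors, an injective parametrisation of a superset of the support
  let E : (Fin n → Fin (d + 1)) → (Fin n →₀ ℕ) := fun e =>
    Finsupp.equivFunOnFinite.symm fun j => (e j : ℕ)
  have hE : ∀ e j, E e j = (e j : ℕ) := fun e j => by simp [E]
  have hinj : Function.Injective E := fun e₁ e₂ h =>
    funext fun j => Fin.ext (by simpa [hE] using DFunLike.congr_fun h j)
  change eval _ (∑ e : Fin n → Fin (d + 1), C (coeff (E e) (f i)) * X e) = eval x (f i)
  rw [map_sum]
  simp_rw [map_mul, eval_C, eval_X]
  rw [eval_eq' x (f i)]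
  have hsum : ∑ e : Fin n → Fin (d + 1), coeff (E e) (f i) * ∏ j, x j ^ (e j : ℕ) =
      ∑ m ∈ Finset.univ.image E, coeff m (f i) * ∏ j, x j ^ m j := by
    rw [Finset.sum_image fun e₁ _ e₂ _ h => hinj h]
    refine Finset.sum_congr rfl fun e _ => ?_
    simp only [hE]
  rw [hsum]
  refine (Finset.sum_subset (fun m hm => ?_) (fun m _ hm => ?_)).symm
  · refine Finset.mem_image.2
      ⟨fun j => (⟨m j, Nat.lt_succ_of_le ?_⟩ : Fin (d + 1)), Finset.mem_univ _, ?_⟩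
    · exact (monomial_le_degreeOf j hm).trans ((degreeOf_le_totalDegree _ _).trans (hf i))
    · ext j
      simp [hE]
  · rw [notMem_support_iff.1 hm, zero_mul]

/-- **Arity bound.** If `f : kⁿ → k^m` has all coordinates of degree `≤ d` and is
`(s, 2)`-elusive, then `s < (d + 1)ⁿ`: otherwise the linear map of
`range_polyMapEval_subset_bddCoeff` on `(d+1)ⁿ ≤ s` variables covers it. [folklore] -/
theorem lt_pow_of_isElusive_of_totalDegree_le {m n s d : ℕ} {f : Fin m → MvPolynomial (Fin n) k}
    (hel : IsElusive f s 2) (hf : ∀ i, (f i).totalDegree ≤ d) : s < (d + 1) ^ n := by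
  classical
  by_contra hs
  have hs' : (d + 1) ^ n ≤ s := not_lt.1 hs
  have hcard : Fintype.card (Fin n → Fin (d + 1)) = (d + 1) ^ n := by simp
  let ε : (Fin n → Fin (d + 1)) ≃ Fin ((d + 1) ^ n) := Fintype.equivFinOfCardEq hcard
  let Γ₀ : Fin m → MvPolynomial (Fin n → Fin (d + 1)) k := fun i =>
    ∑ e : Fin n → Fin (d + 1),
      C (coeff (Finsupp.equivFunOnFinite.symm fun j => (e j : ℕ)) (f i)) * X e
  have hX : ∀ e : Fin n → Fin (d + 1),
      (X e : MvPolynomial (Fin n → Fin (d + 1)) k).totalDegree ≤ 1 := fun e =>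
    (totalDegree_monomial_le _ _).trans (by simp)
  refine (hel.anti_left hs') (fun i => rename ε (Γ₀ i)) (fun i => ?_) ?_
  · refine (totalDegree_rename_le _ _).trans ?_
    refine (totalDegree_finsetSum _ _).trans (Finset.sup_le fun e _ => ?_)
    refine (totalDegree_mul _ _).trans ?_
    rw [totalDegree_C, zero_add]
    exact (hX e).trans one_le_two
  · refine (range_polyMapEval_subset_bddCoeff f hf).trans ?_
    rintro _ ⟨y, rfl⟩
    refine ⟨y ∘ ε.symm, ?_⟩
    rw [polyMapEval_rename]
    congr 1
    funext e
    simp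

end ArityBoundMap

/-! ### Elusiveness is invariant under injective renaming of the variables -/

section Rename

variable {k : Type u} [CommSemiring k]

/-- Renaming the variables of `f` along an injective map does not change the image of the
polynomial mapping (every assignment of the old variables extends to the new ones), hence
preserves `(s, r)`-elusiveness; e.g. adding dummy variables. [folklore] -/
theorem IsElusive.rename_injective {ι : Type v} {σ τ : Type*} {f : ι → MvPolynomial σ k}
    {s r : ℕ} (h : IsElusive f s r) {e : σ → τ} (he : Function.Injective e) :
    IsElusive (fun i => rename e (f i)) s r := by
  refine h.of_range_eq (Set.ext fun v => ⟨?_, ?_⟩)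
  · rintro ⟨y, rfl⟩
    exact ⟨y ∘ e, by rw [polyMapEval_rename]⟩
  · rintro ⟨x, rfl⟩
    obtain ⟨y, hy⟩ := he.surjective_comp_right (γ := k) x
    exact ⟨y, by rw [polyMapEval_rename]; exact congrArg _ hy⟩

/-- Re-indexing the `x`-variables of Def. 1.3 along `e : σ n → σ N` commutes with the bit
substitution (which only touches the `w`-variables). [folklore] -/
theorem bitSubst_rename_sumMap {σ : ℕ → Type v} {n N : ℕ} (e : σ n → σ N) (ℓ K i : ℕ)
    (p : MvPolynomial ((σ n ⊕ Fin ℓ) ⊕ Fin K) k) :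
    bitSubst N ℓ K i (rename (Sum.map (Sum.map e id) id) p) =
      rename (Sum.map e id) (bitSubst n ℓ K i p) := by
  induction p using MvPolynomial.induction_on with
  | C a => simp [bitSubst]
  | add p q hp hq => simp only [map_add, hp, hq]
  | mul_X p v hp =>
    simp only [map_mul, hp, rename_X]
    congr 1
    rcases v with (a | j) | t
    · simp
    · simp
    · simp only [Sum.map_inr, id_eq, bitSubst_X_inr]
      split_ifs <;> simp

end Rename

/-! ### Arithmetic: the quartic root, and the growth hypothesis of Cor. 5.8 when `s ≥ m^{0.9}` -/

/-! Below, the integer quartic root `⌊N^{1/4}⌋` is written `Nat.sqrt (Nat.sqrt N)` (`= ⌊√⌊√N⌋⌋`). -/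

/-- `⌊N^{1/4}⌋⁴ ≤ N`. [folklore] -/
theorem quartRoot_pow_four_le (N : ℕ) : Nat.sqrt (Nat.sqrt N) ^ 4 ≤ N := by
  calc Nat.sqrt (Nat.sqrt N) ^ 4 = (Nat.sqrt (Nat.sqrt N) ^ 2) ^ 2 := by ring
    _ ≤ Nat.sqrt N ^ 2 := Nat.pow_le_pow_left (Nat.sqrt_le' _) 2
    _ ≤ N := Nat.sqrt_le' N

/-- `n⁴ ≤ N → n ≤ ⌊N^{1/4}⌋`. [folklore] -/
theorem le_quartRoot_of_pow_four_le {n N : ℕ} (h : n ^ 4 ≤ N) : n ≤ Nat.sqrt (Nat.sqrt N) :=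
  Nat.le_sqrt.2 (Nat.le_sqrt.2 (le_of_eq_of_le (by ring) h))

/-- `⌊N^{1/4}⌋ ≤ N`. [folklore] -/
theorem quartRoot_le (N : ℕ) : Nat.sqrt (Nat.sqrt N) ≤ N :=
  (Nat.sqrt_le_self _).trans (Nat.sqrt_le_self _)

/-- Statements holding for all large `n` hold for all large `N` at `n = ⌊N^{1/4}⌋`. [folklore] -/
theorem eventually_quartRoot {P : ℕ → Prop} (h : ∃ n₀, ∀ n ≥ n₀, P n) :
    ∃ N₀, ∀ N ≥ N₀, P (Nat.sqrt (Nat.sqrt N)) := by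
  obtain ⟨n₀, h₀⟩ := h
  exact ⟨n₀ ^ 4, fun N hN => h₀ _ (le_quartRoot_of_pow_four_le hN)⟩

/-- `(n + 1)⁴ ≤ n⁸` for `n ≥ 2`. [folklore] -/
theorem succ_pow_four_le_pow_eight {n : ℕ} (hn : 2 ≤ n) : (n + 1) ^ 4 ≤ n ^ 8 :=
  calc (n + 1) ^ 4 ≤ (2 * n) ^ 4 := Nat.pow_le_pow_left (by omega) 4
    _ = 2 ^ 4 * n ^ 4 := by ring
    _ ≤ n ^ 4 * n ^ 4 := Nat.mul_le_mul_right _ (Nat.pow_le_pow_left hn 4)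
    _ = n ^ 8 := by ring

/-- `n⁹ ≤ M` and `M⁹ ≤ S^{10}` give `n⁸ ≤ S`. [folklore] -/
theorem pow_eight_le_of {n M S : ℕ} (h9 : n ^ 9 ≤ M) (hs : M ^ 9 ≤ S ^ 10) : n ^ 8 ≤ S := by
  rcases Nat.eq_zero_or_pos n with rfl | hn
  · simp
  by_contra hlt
  have h1 : S ^ 10 < (n ^ 8) ^ 10 := Nat.pow_lt_pow_left (not_le.1 hlt) (by norm_num)
  have h2 : (n ^ 8) ^ 10 ≤ (n ^ 9) ^ 9 := by
    rw [← pow_mul, ← pow_mul]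
    exact Nat.pow_le_pow_right hn (by norm_num)
  have h3 : (n ^ 9) ^ 9 ≤ M ^ 9 := Nat.pow_le_pow_left h9 9
  omega

/-- From `s < (D + 1)ⁿ` (arity bound), `m⁹ ≤ s^{10}` and `D = poly(n)`: `m ≤ (n^{2n})ⁿ` for
all large `n`. [folklore] -/
theorem eventually_arity_le_pow {m s D : ℕ → ℕ} (hD : IsPBounded D)
    (hsD : ∃ n₀, ∀ n ≥ n₀, s n < (D n + 1) ^ n) (hs : ∃ n₀, ∀ n ≥ n₀, m n ^ 9 ≤ s n ^ 10) :
    ∃ n₀, ∀ n ≥ n₀, m n ≤ (n ^ (2 * n)) ^ n := by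
  obtain ⟨c, hc⟩ : IsPBounded fun n => (D n + 1) ^ 10 :=
    IsPBounded.pow_holds (IsPBounded.add_holds hD (IsPBounded.const 1)) 10
  obtain ⟨n₁, h₁⟩ := hsD
  obtain ⟨n₂, h₂⟩ := hs
  refine ⟨n₁ + n₂ + c + 2, fun n hn => ?_⟩
  have hn2 : 2 ≤ n := by omega
  have hDn : (D n + 1) ^ 10 ≤ n ^ (2 * n) :=
    calc (D n + 1) ^ 10 ≤ n ^ c + c := hc n
      _ ≤ n ^ c + n ^ c := Nat.add_le_add_left (Nat.lt_pow_self hn2).le _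
      _ = 2 * n ^ c := by ring
      _ ≤ n * n ^ c := Nat.mul_le_mul_right _ hn2
      _ = n ^ (c + 1) := by ring
      _ ≤ n ^ (2 * n) := Nat.pow_le_pow_right (by omega) (by omega)
  calc m n ≤ m n ^ 9 := Nat.le_self_pow (by norm_num) _
    _ ≤ s n ^ 10 := h₂ n (by omega)
    _ ≤ ((D n + 1) ^ n) ^ 10 := Nat.pow_le_pow_left (h₁ n (by omega)).le 10
    _ = ((D n + 1) ^ 10) ^ n := by rw [← pow_mul, ← pow_mul, mul_comm]
    _ ≤ (n ^ (2 * n)) ^ n := Nat.pow_le_pow_left hDn n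

/-- Admissibility of the rank `n²` at the re-indexed level: if `n⁴ ≤ N` and `M ≤ (n^{2n})ⁿ`
then `M ≤ C(N + n² - 1, n²)` (as `Nᵗ ≤ tᵗ · C(N + t - 1, t)`). [folklore] -/
theorem le_choose_multiset_of_le_pow {n N M : ℕ} (hn : 1 ≤ n) (hN : n ^ 4 ≤ N)
    (hM : M ≤ (n ^ (2 * n)) ^ n) : M ≤ Nat.choose (N + n * n - 1) (n * n) := by
  have hT := pow_mul_choose_multiset_le (n := N) (a := n * n) (b := 0) (n * n) (by simp)
  simp only [Nat.zero_add, Nat.add_zero, Nat.choose_zero_right, mul_one] at hT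
  have hpos : 0 < (n * n) ^ (n * n) := Nat.pow_pos (Nat.mul_pos hn hn)
  refine Nat.le_of_mul_le_mul_left ?_ hpos
  calc (n * n) ^ (n * n) * M ≤ (n * n) ^ (n * n) * (n ^ (2 * n)) ^ n := Nat.mul_le_mul_left _ hM
    _ = (n ^ 4) ^ (n * n) := by ring
    _ ≤ N ^ (n * n) := Nat.pow_le_pow_left hN _
    _ ≤ (n * n) ^ (n * n) * Nat.choose (N + n * n - 1) (n * n) := hT

/-- **Growth hypothesis of Cor. 5.8 for the minimal rank when `s ≥ m^{0.9}`.** With `r N ≥ 3`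
minimal such that `M N ≤ C(N + r N - 1, r N)`, `(r N)² ≤ N` eventually, `r N → ∞` and
`M⁹ ≤ s^{10}` eventually: for every `c`, `N^c · C(N + r' - 1, r') ≤ s N` eventually,
`r' = ⌊2 r / 3⌋`. [folklore] -/
theorem rank_growth_of_pow_le (M r s : ℕ → ℕ)
    (hmin : ∀ N j, 3 ≤ j → j < r N → Nat.choose (N + j - 1) j < M N)
    (hsq : ∃ N₀, ∀ N ≥ N₀, r N * r N ≤ N) (hR : ∀ R : ℕ, ∃ N₀, ∀ N ≥ N₀, R ≤ r N)
    (hs : ∃ N₀, ∀ N ≥ N₀, M N ^ 9 ≤ s N ^ 10) (c : ℕ) :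
    ∃ N₀, ∀ N ≥ N₀, N ^ c * Nat.choose (N + 2 * r N / 3 - 1) (2 * r N / 3) ≤ s N := by
  obtain ⟨N₁, h₁⟩ := hsq
  obtain ⟨N₂, h₂⟩ := hR (15 * c + 12)
  obtain ⟨N₃, h₃⟩ := hs
  refine ⟨N₁ + N₂ + N₃ + 1, fun N hN => ?_⟩
  have hrr : r N * r N ≤ N := h₁ N (by omega)
  have hRle : 15 * c + 12 ≤ r N := h₂ N (by omega)
  have hMs : M N ^ 9 ≤ s N ^ 10 := h₃ N (by omega)
  have hN1 : 1 ≤ N := by omega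
  obtain ⟨a, ha⟩ : ∃ a, r N = a + 1 := ⟨r N - 1, by omega⟩
  have hlt' : ∀ j, 3 ≤ j → j < a + 1 → Nat.choose (N + j - 1) j < M N := fun j hj hja =>
    hmin N j hj (ha ▸ hja)
  rw [ha] at hrr hRle ⊢
  set b := 2 * (a + 1) / 3 with hb
  obtain ⟨t, hbt⟩ : ∃ t, a = b + t := ⟨a - b, by omega⟩
  have ht5 : 5 * c + 1 ≤ t := by omega
  have hb2 : b ≤ 2 * t + 2 := by omega
  have haa : (b + t) * (b + t) ≤ N := by
    rw [← hbt]
    exact le_trans (Nat.mul_le_mul (Nat.le_succ a) (Nat.le_succ a)) hrr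
  have hlt : Nat.choose (N + (b + t) - 1) (b + t) < M N := by
    rw [← hbt]
    exact hlt' a (by omega) (by omega)
  have hA := pow_mul_choose_multiset_le (n := N) (a := b + t) (b := b) t le_rfl
  have hCb : Nat.choose (N + b - 1) b ≤ N ^ b := choose_multiset_le_pow hN1 b
  have hat : (b + t) ^ (9 * t) ≤ N ^ (5 * t) :=
    calc (b + t) ^ (9 * t) ≤ (b + t) ^ (10 * t) := Nat.pow_le_pow_right (by omega) (by omega)
      _ = ((b + t) * (b + t)) ^ (5 * t) := by rw [← pow_two, ← pow_mul]; ring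
      _ ≤ N ^ (5 * t) := Nat.pow_le_pow_left haa _
  have key : (N ^ c * Nat.choose (N + b - 1) b) ^ 10 * N ^ (9 * t) ≤
      Nat.choose (N + (b + t) - 1) (b + t) ^ 9 * N ^ (9 * t) :=
    calc (N ^ c * Nat.choose (N + b - 1) b) ^ 10 * N ^ (9 * t)
        = N ^ (10 * c) * Nat.choose (N + b - 1) b *
            (N ^ t * Nat.choose (N + b - 1) b) ^ 9 := by ring
      _ ≤ N ^ (10 * c) * N ^ b *
            ((b + t) ^ t * Nat.choose (N + (b + t) - 1) (b + t)) ^ 9 :=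
          Nat.mul_le_mul (Nat.mul_le_mul_left _ hCb) (Nat.pow_le_pow_left hA 9)
      _ = N ^ (10 * c + b) * (b + t) ^ (9 * t) * Nat.choose (N + (b + t) - 1) (b + t) ^ 9 := by
          ring
      _ ≤ N ^ (10 * c + b) * N ^ (5 * t) * Nat.choose (N + (b + t) - 1) (b + t) ^ 9 :=
          Nat.mul_le_mul_right _ (Nat.mul_le_mul_left _ hat)
      _ = N ^ (10 * c + b + 5 * t) * Nat.choose (N + (b + t) - 1) (b + t) ^ 9 := by ring
      _ ≤ N ^ (9 * t) * Nat.choose (N + (b + t) - 1) (b + t) ^ 9 :=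
          Nat.mul_le_mul_right _ (Nat.pow_le_pow_right hN1 (by omega))
      _ = _ := mul_comm _ _
  have key' : (N ^ c * Nat.choose (N + b - 1) b) ^ 10 ≤
      Nat.choose (N + (b + t) - 1) (b + t) ^ 9 :=
    Nat.le_of_mul_le_mul_right key (Nat.pow_pos hN1)
  have hfin : (N ^ c * Nat.choose (N + b - 1) b) ^ 10 ≤ s N ^ 10 :=
    key'.trans ((Nat.pow_le_pow_left hlt.le 9).trans hMs)
  exact (Nat.pow_le_pow_iff_left (by norm_num : (10 : ℕ) ≠ 0)).1 hfin

/-! ### `Raz2010_cor_5_8` ⇒ `Raz2010_result_1` -/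

/-- **Raz 2010, §1 result 1 from Cor. 5.8 = Cor. 1.14** (p. 136: "For example, we show the
following results: … 1. …"; the theorem behind the example is Cor. 1.14, restated and proved as
Cor. 5.8): `Raz2010_cor_5_8 F → Raz2010_result_1 F`, by the reduction described in the module
docstring — arity bound `m ≤ (n^{2n})ⁿ` from elusiveness and the degree bound, re-indexing by
`N` with `n = ⌊N^{1/4}⌋` (dummy variables), padding by Raz's formula of Def. 1.3 to the
binomial arity `C(N + r - 1, r)` with `r` minimal (so `r ≤ n² ≤ √N`), and the growth hypothesis
`s / C(N + r' - 1, r') ≥ N^{ω(1)}` from `s ≥ m^{0.9}` and the minimality of `r`; Cor. 5.8 is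
applied over the extension `G = F`.
[cite: Raz2010, §1 result 1 (p. 136), Cor. 1.14 (p. 147), Cor. 5.8 (p. 172)] -/
theorem Raz2010_result_1_of_cor_5_8 {F : Type u} [Field F] (h : Raz2010_cor_5_8 F) :
    Raz2010_result_1 F := by
  intro hF m s f hm hs hexp hdeg hel
  classical
  obtain ⟨r, hr3, hrmin, hrlt⟩ := exists_rank_function fun N => m (Nat.sqrt (Nat.sqrt N))
  obtain ⟨ℓ, g, hℓ, hgdeg, hgcx, hgid⟩ := hexp
  obtain ⟨n₀, h₀⟩ := hel
  have hqr : IsPBounded fun N => Nat.sqrt (Nat.sqrt N) :=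
    IsPBounded.id.mono fun N => quartRoot_le N
  have hlt4 : ∀ N, N ≤ (Nat.sqrt (Nat.sqrt N) + 1) ^ 4 := fun N =>
    le_of_not_ge fun h4 => Nat.lt_irrefl _ (le_quartRoot_of_pow_four_le h4)
  -- degree bound per coordinate
  have hdegi : ∀ n (i : Fin (m n)), (f n i).totalDegree ≤
      Finset.univ.sup fun i : Fin (m n) => (f n i).totalDegree := fun n i =>
    Finset.le_sup (f := fun i : Fin (m n) => (f n i).totalDegree) (Finset.mem_univ i)
  -- (1) arity bound: `m n ≤ (n^{2n})ⁿ` for large `n`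
  obtain ⟨n₁, h₁⟩ : ∃ n₁, ∀ n ≥ n₁, m n ≤ (n ^ (2 * n)) ^ n :=
    eventually_arity_le_pow hdeg
      ⟨n₀, fun n hn => lt_pow_of_isElusive_of_totalDegree_le (h₀ n hn) (hdegi n)⟩ hs
  obtain ⟨n₉, h₉⟩ := hm 9
  obtain ⟨nₛ, hₛ⟩ := hs
  have hs8 : ∀ n, n₉ + nₛ ≤ n → n ^ 8 ≤ s n := fun n hn =>
    pow_eight_le_of (h₉ n (by omega)) (hₛ n (by omega))
  -- (2) admissibility at the re-indexed level: `r N ≤ n²` and `m n ≤ C(N + r N - 1, r N)`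
  have hadm : ∀ N, (n₁ + 2) ^ 4 ≤ N →
      r N ≤ Nat.sqrt (Nat.sqrt N) * Nat.sqrt (Nat.sqrt N) ∧
        m (Nat.sqrt (Nat.sqrt N)) ≤ Nat.choose (N + r N - 1) (r N) := by
    intro N hN
    have hn : n₁ + 2 ≤ Nat.sqrt (Nat.sqrt N) := le_quartRoot_of_pow_four_le hN
    refine hrmin N (Nat.sqrt (Nat.sqrt N) * Nat.sqrt (Nat.sqrt N)) (by nlinarith) ?_
    exact le_choose_multiset_of_le_pow (by omega) (quartRoot_pow_four_le N) (h₁ _ (by omega))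
  have hmM : ∀ N, 2 ≤ N → m (Nat.sqrt (Nat.sqrt N)) ≤ Nat.choose (N + r N - 1) (r N) :=
    fun N hN =>
      (hrmin N _ (le_max_left _ _) (le_choose_multiset_max (m (Nat.sqrt (Nat.sqrt N))) N hN)).2
  -- the re-indexed arity is super-polynomial in `N`
  have hm' : ∀ c : ℕ, ∃ N₀, ∀ N ≥ N₀, N ^ c ≤ m (Nat.sqrt (Nat.sqrt N)) := by
    intro c
    obtain ⟨n₂, h₂⟩ := hm (8 * c)
    refine ⟨(n₂ + 2) ^ 4, fun N hN => ?_⟩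
    have hn : n₂ + 2 ≤ Nat.sqrt (Nat.sqrt N) := le_quartRoot_of_pow_four_le hN
    calc N ^ c ≤ ((Nat.sqrt (Nat.sqrt N) + 1) ^ 4) ^ c :=
          Nat.pow_le_pow_left (hlt4 N) c
      _ ≤ (Nat.sqrt (Nat.sqrt N) ^ 8) ^ c :=
          Nat.pow_le_pow_left (succ_pow_four_le_pow_eight (by omega)) c
      _ = Nat.sqrt (Nat.sqrt N) ^ (8 * c) := by rw [← pow_mul]
      _ ≤ m (Nat.sqrt (Nat.sqrt N)) := h₂ _ (by omega)
  -- (3) apply Cor. 5.8 to the re-indexed padded family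
  refine h hF r (fun N => s (Nat.sqrt (Nat.sqrt N)))
    (fun N i => rename (Fin.castLE (quartRoot_le N))
      (boolSum (bitSubst (Nat.sqrt (Nat.sqrt N)) (ℓ (Nat.sqrt (Nat.sqrt N)))
        (Nat.clog 2 (m (Nat.sqrt (Nat.sqrt N)))) i (g (Nat.sqrt (Nat.sqrt N)))))) ?_ ?_ ?_ ?_
  · -- `3 ≤ r ≤ N ≤ s` eventually
    refine ⟨(n₁ + 2) ^ 4 + (n₉ + nₛ + 2) ^ 4, fun N hN => ⟨hr3 N, ?_, ?_⟩⟩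
    · have hq : 1 ≤ Nat.sqrt (Nat.sqrt N) := by
        have := le_quartRoot_of_pow_four_le (n := n₁ + 2) (N := N) (by omega)
        omega
      calc r N ≤ Nat.sqrt (Nat.sqrt N) * Nat.sqrt (Nat.sqrt N) := (hadm N (by omega)).1
        _ = Nat.sqrt (Nat.sqrt N) ^ 2 := (sq _).symm
        _ ≤ Nat.sqrt (Nat.sqrt N) ^ 4 := Nat.pow_le_pow_right hq (by norm_num)
        _ ≤ N := quartRoot_pow_four_le N
    · have hn : n₉ + nₛ + 2 ≤ Nat.sqrt (Nat.sqrt N) := le_quartRoot_of_pow_four_le (by omega)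
      calc N ≤ (Nat.sqrt (Nat.sqrt N) + 1) ^ 4 := hlt4 N
        _ ≤ Nat.sqrt (Nat.sqrt N) ^ 8 := succ_pow_four_le_pow_eight (by omega)
        _ ≤ s (Nat.sqrt (Nat.sqrt N)) := hs8 _ (by omega)
  · -- growth: `N^c · C(N + r' - 1, r') ≤ s` eventually
    intro c
    refine rank_growth_of_pow_le (fun N => m (Nat.sqrt (Nat.sqrt N))) r
      (fun N => s (Nat.sqrt (Nat.sqrt N))) hrlt ⟨(n₁ + 2) ^ 4, fun N hN => ?_⟩
      (rank_eventually_ge _ r hm' hrmin)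
      (eventually_quartRoot (P := fun n => m n ^ 9 ≤ s n ^ 10) ⟨nₛ, hₛ⟩) c
    have hr := (hadm N hN).1
    calc r N * r N ≤ (Nat.sqrt (Nat.sqrt N) * Nat.sqrt (Nat.sqrt N)) *
          (Nat.sqrt (Nat.sqrt N) * Nat.sqrt (Nat.sqrt N)) := Nat.mul_le_mul hr hr
      _ = Nat.sqrt (Nat.sqrt N) ^ 4 := by ring
      _ ≤ N := quartRoot_pow_four_le N
  · -- Def. 1.3 for the re-indexed padded family, with the same witnesses `g n` re-indexed
    refine ⟨fun N => ℓ (Nat.sqrt (Nat.sqrt N)), fun N =>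
      if hle : m (Nat.sqrt (Nat.sqrt N)) ≤ Nat.choose (N + r N - 1) (r N) then
        rename (Sum.map id (Fin.castLE (Nat.clog_mono_right 2 hle)))
          (rename (Sum.map (Sum.map (Fin.castLE (quartRoot_le N)) id) id)
            (g (Nat.sqrt (Nat.sqrt N))))
      else rename Sum.inl (rename (Sum.map (Fin.castLE (quartRoot_le N)) id)
        (bitSubst (Nat.sqrt (Nat.sqrt N)) (ℓ (Nat.sqrt (Nat.sqrt N)))
          (Nat.clog 2 (m (Nat.sqrt (Nat.sqrt N)))) 0 (g (Nat.sqrt (Nat.sqrt N))))),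
      IsPBounded.comp_holds hℓ hqr, ?_, ?_, ?_⟩
    · refine IsPBounded.of_eventually_le 2 (IsPBounded.comp_holds hgdeg hqr) fun N hN => ?_
      simp only [dif_pos (hmM N hN)]
      exact (totalDegree_rename_le _ _).trans (totalDegree_rename_le _ _)
    · refine IsPBounded.of_eventually_le 2 (IsPBounded.comp_holds hgcx hqr) fun N hN => ?_
      simp only [dif_pos (hmM N hN)]
      exact (complexity_rename_le_holds' _ _).trans (complexity_rename_le_holds' _ _)
    · intro N i
      by_cases hle : m (Nat.sqrt (Nat.sqrt N)) ≤ Nat.choose (N + r N - 1) (r N)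
      · simp only [dif_pos hle, bitSubst_rename_castLE, bitSubst_rename_sumMap,
          boolSum_rename_sumMap]
      · -- only `N ≤ 1` can fail admissibility; then the arity is `≤ 1` and `i = 0`
        have hN : N < 2 := not_le.1 fun hN => hle (hmM N hN)
        have hM : Nat.choose (N + r N - 1) (r N) ≤ 1 := by
          have h3 := hr3 N
          rcases (show N = 0 ∨ N = 1 by omega) with rfl | rfl
          · rw [Nat.choose_eq_zero_of_lt (by omega)]
            exact Nat.zero_le _
          · rw [show 1 + r 1 - 1 = r 1 by omega, Nat.choose_self]
        have hi2 : (i : ℕ) < Nat.choose (N + r N - 1) (r N) := i.2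
        have hi : (i : ℕ) = 0 := by omega
        simp only [dif_neg hle, bitSubst_rename_inl, boolSum_rename_sumMap, hi]
  · -- elusiveness of the re-indexed padded family over `G = F`
    refine ⟨(n₁ + 2) ^ 4 + n₀ ^ 4, fun N hN => exists_extension_isElusive_of_isElusive ?_⟩
    have hle := (hadm N (by omega)).2
    have hn0 : n₀ ≤ Nat.sqrt (Nat.sqrt N) := le_quartRoot_of_pow_four_le (by omega)
    refine IsElusive.rename_injective ?_ (Fin.castLE_injective _)
    exact (h₀ _ hn0).of_comp (Fin.castLE hle) fun i => (hgid _ _).symm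

/-- **Result 1 from the remaining named facts.** Composed with `Raz2010_cor_5_8_of_parts`
(`RazElusiveGeneralRoute.lean`), `Raz2010_prop_5_5_of_monomialCircuits`
(`RazElusiveGeneralDefinable.lean`) and Valiant's theorem `isVNPComplete_perPoly_holds`
(`ValiantCompleteness.lean`): §1 result 1 rests on step 1 of the proof of Prop. 3.6 / 5.5
(`Raz2010_monomialCircuits`) and on Cor. 5.7 (`Raz2010_cor_5_7`) only.
[cite: Raz2010, §1 result 1 (p. 136), Cor. 5.8 (p. 172)] -/
theorem Raz2010_result_1_of_parts {F : Type u} [Field F] (hMC : Raz2010_monomialCircuits)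
    (h57 : Raz2010_cor_5_7 F) : Raz2010_result_1 F :=
  Raz2010_result_1_of_cor_5_8
    (Raz2010_cor_5_8_of_parts (Raz2010_prop_5_5_of_monomialCircuits hMC) h57
      (isVNPComplete_perPoly_holds F))

end Literature.Computability.AlgebraicComplexity

end
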